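import Summits.SmoothPoincare4.SmoothPoincare4.Theorems.ConvexBisectionAcyclicBisectionExistsEOneCurveGeometry
import Summits.SmoothPoincare4.SmoothPoincare4.Theorems.ConvexBisectionAcyclicBisectionExistsCrossingStdSymp
import HarnessLib

/-!
# A vanishing cycle over `[ζ_3, ζ_4]` crossing the four-point annulus radially
(wave 7, brick H5-4 of the last geometric input (R-E1CURVE) of node N3a `node_STcurve` of stub
`stub_STgeo` = NF4 N3, line `modp-braid-orbits`, crux `ConvexBisection.AcyclicBisectionExists`,
item stmt-SmoothPoincare4-10508; registered sub-goal `helper_eOne_sheetLoop`)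

The pairing of the `e_1`-curve with `chainVec g 3` is the crossing number of OUR annulus chart
`eoChart` (round circles around `c₀ = eoCenter g`) with ANY page loop of shadow `chainVec g 3`
(`crossingNumber_eq_stdSymp`, `stdSymp_int_swap`).  This file builds the convenient one: the SHEET
LOOP (`sheetAmb`, Y4) over the closed `x`-path `eoPath g` which runs from `ζ_3` straight to the
point `P_in = c₀ + (R − κ) d` of the ray from `c₀` through `ζ_4` (`d = eoDir g`), then RADIALLY
along that ray to `ζ_4` (`τ ∈ [1/4, 1/2]`, radius `eoRho g τ` affine), and back the same way
(`eoPath (1 − τ) = eoPath τ`) — upper sheet out, lower sheet back.  It stays in the closed unit disc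
(the ray segment `[c₀, ζ_4]` and the segment `[ζ_3, P_in]`), passes the branch points `ζ_3`, `ζ_4`
at `τ = 0, 1/2`, and is joined to the chord zig-zag `chordZig g 3` by the straight-line family, so
its shadow is `chainVec g 3` (`shadow_eq_of_sheet_family`, `helper_shadow_sheetLoop_chain`):
**`helper_eOne_sheetLoop`**.  The reversed loop (`∘ reflS`) traces the same path with the sheets
exchanged.  Everything is proved; no `sorry`.  References: J. Milnor, *Singular points of complex
hypersurfaces* (1968), §9 [Milnor1968]; A. Hatcher, *Algebraic Topology* (2002), Thm. 2A.1
[HatcherAT2002].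
-/

noncomputable section

set_option linter.dupNamespace false

open scoped Manifold ContDiff Topology ComplexConjugate Real
open Set Function Metric Complex
open Literature.Topology.FourManifolds Literature.Topology.FourManifolds.LefschetzBase
  Literature.Topology.FourManifolds.TorusKnotMilnor

namespace Summit.SmoothPoincare4.SmoothPoincare4.Theorems.AcyclicBisectionExists.ModpBraidOrbits

variable {g : ℕ}

/-! ## §1 The ray from the centre through `ζ_4` -/

/-- **The unit direction** `d = (ζ_4 − c₀)/‖ζ_4 − c₀‖` of the ray from `c₀` through `ζ_4`. [folklore] -/
def eoDir (g : ℕ) : ℂ := ((‖branchPt g 4 - eoCenter g‖⁻¹ : ℝ) : ℂ) * (branchPt g 4 - eoCenter g)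

/-- `‖ζ_4 − c₀‖ > R + 2κ > 0` (`g ≥ 2`). [folklore] -/
theorem norm_four_sub_center_gt (hg : 2 ≤ g) : eoRad g + 2 * eoKap g < ‖branchPt g 4 - eoCenter g‖ :=
  (helper_eOne_radii g hg 4).2 le_rfl (by omega)

/-- `0 < ‖ζ_4 − c₀‖`. [folklore] -/
theorem norm_four_sub_center_pos (hg : 2 ≤ g) : 0 < ‖branchPt g 4 - eoCenter g‖ := by
  have := norm_four_sub_center_gt hg; have := eoRad_ge g; have := (eoKap_bounds hg).1; linarith

/-- `‖d‖ = 1`. [folklore] -/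
theorem norm_eoDir (hg : 2 ≤ g) : ‖eoDir g‖ = 1 := by
  rw [eoDir, norm_mul, Complex.norm_real, Real.norm_eq_abs, abs_of_pos (inv_pos.2 (norm_four_sub_center_pos hg)),
    inv_mul_cancel₀ (norm_four_sub_center_pos hg).ne']

/-- `c₀ + ‖ζ_4 − c₀‖ d = ζ_4`. [folklore] -/
theorem center_add_norm_mul_eoDir (hg : 2 ≤ g) :
    eoCenter g + ((‖branchPt g 4 - eoCenter g‖ : ℝ) : ℂ) * eoDir g = branchPt g 4 := by
  rw [eoDir, ← mul_assoc, ← Complex.ofReal_mul, mul_inv_cancel₀ (norm_four_sub_center_pos hg).ne']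
  push_cast; ring

/-- **The ray point at radius `ρ ∈ [0, ‖ζ_4 − c₀‖]` lies in the closed unit disc, strictly inside
for `ρ < ‖ζ_4 − c₀‖`** (a convex combination of `c₀`, `‖c₀‖ = 2/5`, and `ζ_4`). [folklore] -/
theorem norm_ray_le (hg : 2 ≤ g) {ρ : ℝ} (h0 : 0 ≤ ρ) (h1 : ρ ≤ ‖branchPt g 4 - eoCenter g‖) :
    ‖eoCenter g + (ρ : ℂ) * eoDir g‖ ≤ 1 - (3 / 5) * (1 - ρ / ‖branchPt g 4 - eoCenter g‖) := by
  set D := ‖branchPt g 4 - eoCenter g‖ with hD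
  have hDp : 0 < D := norm_four_sub_center_pos hg
  have e : eoCenter g + (ρ : ℂ) * eoDir g = ((1 - ρ / D : ℝ) : ℂ) * eoCenter g + ((ρ / D : ℝ) : ℂ) * branchPt g 4 := by
    rw [eoDir, ← hD]; push_cast; field_simp; ring
  rw [e]
  have hl : 0 ≤ 1 - ρ / D := by rw [sub_nonneg, div_le_one hDp]; exact h1
  calc ‖((1 - ρ / D : ℝ) : ℂ) * eoCenter g + ((ρ / D : ℝ) : ℂ) * branchPt g 4‖
      ≤ ‖((1 - ρ / D : ℝ) : ℂ) * eoCenter g‖ + ‖((ρ / D : ℝ) : ℂ) * branchPt g 4‖ := norm_add_le _ _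
    _ = (1 - ρ / D) * (2 / 5) + ρ / D := by
        rw [norm_mul, norm_mul, Complex.norm_real, Complex.norm_real, Real.norm_eq_abs, Real.norm_eq_abs,
          abs_of_nonneg hl, abs_of_nonneg (by positivity), norm_eoCenter, norm_branchPt, mul_one]
    _ = 1 - (3 / 5) * (1 - ρ / D) := by ring

/-! ## §2 The closed `x`-path -/

/-- **The radius on the radial leg**: affine from `R − κ` at `τ = 1/4` to `‖ζ_4 − c₀‖` at `τ = 1/2`.
[folklore] -/
def eoRho (g : ℕ) (τ : ℝ) : ℝ :=
  (eoRad g - eoKap g) + (4 * τ - 1) * (‖branchPt g 4 - eoCenter g‖ - (eoRad g - eoKap g))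

/-- **The out-going half**: straight from `ζ_3` to `P_in = c₀ + (R − κ) d` on `[0, 1/4]`, then
radially out to `ζ_4` on `[1/4, 1/2]`. [folklore] -/
def eoXout (g : ℕ) (τ : ℝ) : ℂ :=
  if τ ≤ 1 / 4 then branchPt g 3 + ((4 * τ : ℝ) : ℂ) * (eoCenter g + ((eoRad g - eoKap g : ℝ) : ℂ) * eoDir g - branchPt g 3)
  else eoCenter g + (eoRho g τ : ℂ) * eoDir g

/-- **The closed `x`-path**: out on `[0, 1/2]`, back the same way on `[1/2, 1]`. [folklore] -/
def eoPath (g : ℕ) (τ : ℝ) : ℂ := if τ ≤ 1 / 2 then eoXout g τ else eoXout g (1 - τ)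

/-- The radius at the ends of the radial leg. [folklore] -/
theorem eoRho_ends (g : ℕ) : eoRho g (1 / 4) = eoRad g - eoKap g ∧ eoRho g (1 / 2) = ‖branchPt g 4 - eoCenter g‖ := by
  unfold eoRho; constructor <;> ring

/-- On `[1/4, 1/2]` the radius lies in `[R − κ, ‖ζ_4 − c₀‖]`. [folklore] -/
theorem eoRho_mem (hg : 2 ≤ g) {τ : ℝ} (hτ : τ ∈ Icc (1 / 4 : ℝ) (1 / 2)) :
    eoRho g τ ∈ Icc (eoRad g - eoKap g) ‖branchPt g 4 - eoCenter g‖ := by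
  have h := norm_four_sub_center_gt hg
  have hk := (eoKap_bounds hg).1
  unfold eoRho
  constructor <;> nlinarith [hτ.1, hτ.2]

/-- `eoRho` is continuous. [folklore] -/
theorem continuous_eoRho (g : ℕ) : Continuous (eoRho g) := by unfold eoRho; fun_prop

/-- The out-going half is continuous (the two legs meet at `P_in`). [folklore] -/
theorem continuous_eoXout (g : ℕ) : Continuous (eoXout g) := by
  unfold eoXout
  refine Continuous.if_le (by fun_prop) ?_ continuous_id continuous_const fun τ hτ => ?_
  · exact continuous_const.add ((Complex.continuous_ofReal.comp (continuous_eoRho g)).mul continuous_const)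
  · rw [hτ, (eoRho_ends g).1]; push_cast; ring

/-- **The closed path is continuous.** [folklore] -/
theorem continuous_eoPath (g : ℕ) : Continuous (eoPath g) := by
  unfold eoPath
  refine Continuous.if_le (continuous_eoXout g) ((continuous_eoXout g).comp (by fun_prop)) continuous_id
    continuous_const fun τ hτ => ?_
  rw [hτ]; norm_num

/-- The path is symmetric: `eoPath (1 − τ) = eoPath τ`. [folklore] -/
theorem eoPath_one_sub (g : ℕ) (τ : ℝ) : eoPath g (1 - τ) = eoPath g τ := by
  unfold eoPath
  by_cases h : τ ≤ 1 / 2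
  · by_cases h' : 1 - τ ≤ 1 / 2
    · have : τ = 1 / 2 := by linarith
      subst this; norm_num
    · rw [if_neg h', if_pos h, sub_sub_cancel]
  · rw [if_pos (by linarith), if_neg h]

/-- On `[1/4, 1/2]` the path is the ray point at radius `eoRho g τ`. [folklore] -/
theorem eoPath_of_mem_rad {τ : ℝ} (hτ : τ ∈ Icc (1 / 4 : ℝ) (1 / 2)) :
    eoPath g τ = eoCenter g + (eoRho g τ : ℂ) * eoDir g := by
  rw [eoPath, if_pos hτ.2, eoXout]
  by_cases h : τ ≤ 1 / 4
  · have : τ = 1 / 4 := le_antisymm h hτ.1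
    rw [if_pos h, this, (eoRho_ends g).1]; push_cast; ring
  · rw [if_neg h]

/-- On `[0, 1/4]` the path is on the segment `[ζ_3, P_in]`. [folklore] -/
theorem eoPath_of_le_quarter {τ : ℝ} (hτ : τ ≤ 1 / 4) :
    eoPath g τ = branchPt g 3 + ((4 * τ : ℝ) : ℂ) * (eoCenter g + ((eoRad g - eoKap g : ℝ) : ℂ) * eoDir g - branchPt g 3) := by
  rw [eoPath, if_pos (by linarith), eoXout, if_pos hτ]

/-- End points and midpoint: `ζ_3` at `τ = 0, 1` and `ζ_4` at `τ = 1/2`. [folklore] -/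
theorem eoPath_ends (hg : 2 ≤ g) : eoPath g 0 = branchPt g 3 ∧ eoPath g 1 = branchPt g 3 ∧ eoPath g (1 / 2) = branchPt g 4 := by
  refine ⟨?_, ?_, ?_⟩
  · rw [eoPath_of_le_quarter (by norm_num)]; push_cast; ring
  · rw [← eoPath_one_sub, sub_self, eoPath_of_le_quarter (by norm_num)]; push_cast; ring
  · rw [eoPath_of_mem_rad ⟨by norm_num, le_rfl⟩, (eoRho_ends g).2, center_add_norm_mul_eoDir hg]

/-- **On the segment leg the path is within `R − κ` of the centre** (both ends are). [folklore] -/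
theorem norm_eoPath_sub_center_le {τ : ℝ} (hg : 2 ≤ g) (h0 : 0 ≤ τ) (hτ : τ ≤ 1 / 4) :
    ‖eoPath g τ - eoCenter g‖ ≤ eoRad g - eoKap g := by
  rw [eoPath_of_le_quarter hτ]
  have h3 : ‖branchPt g 3 - eoCenter g‖ ≤ eoRad g - eoKap g := by
    have := (helper_eOne_radii g hg 3).1 (by norm_num); have := (eoKap_bounds hg).1; linarith
  have hP : ‖((eoRad g - eoKap g : ℝ) : ℂ) * eoDir g‖ = eoRad g - eoKap g := by
    rw [norm_mul, norm_eoDir hg, mul_one, Complex.norm_real, Real.norm_eq_abs, abs_of_nonneg]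
    have := eoRad_ge g; have := (eoKap_bounds hg).2; linarith
  have e : branchPt g 3 + ((4 * τ : ℝ) : ℂ) * (eoCenter g + ((eoRad g - eoKap g : ℝ) : ℂ) * eoDir g - branchPt g 3) - eoCenter g
      = ((1 - 4 * τ : ℝ) : ℂ) * (branchPt g 3 - eoCenter g) + ((4 * τ : ℝ) : ℂ) * (((eoRad g - eoKap g : ℝ) : ℂ) * eoDir g) := by
    push_cast; ring
  rw [e]
  have h14 : 0 ≤ 1 - 4 * τ := by linarith
  calc _ ≤ ‖((1 - 4 * τ : ℝ) : ℂ) * (branchPt g 3 - eoCenter g)‖ + ‖((4 * τ : ℝ) : ℂ) * (((eoRad g - eoKap g : ℝ) : ℂ) * eoDir g)‖ :=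
        norm_add_le _ _
    _ = (1 - 4 * τ) * ‖branchPt g 3 - eoCenter g‖ + 4 * τ * (eoRad g - eoKap g) := by
        rw [norm_mul, norm_mul, hP, Complex.norm_real, Complex.norm_real, Real.norm_eq_abs, Real.norm_eq_abs,
          abs_of_nonneg h14, abs_of_nonneg (by linarith)]
    _ ≤ (1 - 4 * τ) * (eoRad g - eoKap g) + 4 * τ * (eoRad g - eoKap g) := by
        nlinarith [mul_le_mul_of_nonneg_left h3 h14]
    _ = eoRad g - eoKap g := by ring

/-- `‖P_in‖ ≤ 1` for the inner end `P_in = c₀ + (R − κ) d` of the radial leg. [folklore] -/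
theorem norm_Pin_le (hg : 2 ≤ g) : ‖eoCenter g + ((eoRad g - eoKap g : ℝ) : ℂ) * eoDir g‖ ≤ 1 := by
  have hD := norm_four_sub_center_gt hg
  have hk := (eoKap_bounds hg).1
  have h0 : 0 ≤ eoRad g - eoKap g := by have := eoRad_ge g; have := (eoKap_bounds hg).2; linarith
  have h1 : eoRad g - eoKap g ≤ ‖branchPt g 4 - eoCenter g‖ := by linarith
  have := norm_ray_le hg h0 h1
  have : 0 ≤ 1 - (eoRad g - eoKap g) / ‖branchPt g 4 - eoCenter g‖ := by
    rw [sub_nonneg, div_le_one (norm_four_sub_center_pos hg)]; exact h1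
  nlinarith

/-- **The path stays in the closed unit disc on `[0, 1]`.** [folklore] -/
theorem norm_eoPath_le (hg : 2 ≤ g) {τ : ℝ} (hτ : τ ∈ Icc (0 : ℝ) 1) : ‖eoPath g τ‖ ≤ 1 := by
  -- reduce to `[0, 1/2]`
  wlog h : τ ≤ 1 / 2 generalizing τ
  · have := this (τ := 1 - τ) ⟨by linarith [hτ.2], by linarith [hτ.1]⟩ (by linarith)
    rwa [eoPath_one_sub] at this
  have hD := norm_four_sub_center_gt hg
  have hk := (eoKap_bounds hg).1
  rcases le_or_gt τ (1 / 4) with h4 | h4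
  · -- segment leg: a convex combination of `ζ_3` and `P_in`
    rw [eoPath_of_le_quarter h4]
    have h14 : 0 ≤ 1 - 4 * τ := by linarith
    have e : branchPt g 3 + ((4 * τ : ℝ) : ℂ) * (eoCenter g + ((eoRad g - eoKap g : ℝ) : ℂ) * eoDir g - branchPt g 3)
        = ((1 - 4 * τ : ℝ) : ℂ) * branchPt g 3 + ((4 * τ : ℝ) : ℂ) * (eoCenter g + ((eoRad g - eoKap g : ℝ) : ℂ) * eoDir g) := by
      push_cast; ring
    rw [e]
    calc _ ≤ ‖((1 - 4 * τ : ℝ) : ℂ) * branchPt g 3‖ + ‖((4 * τ : ℝ) : ℂ) * (eoCenter g + ((eoRad g - eoKap g : ℝ) : ℂ) * eoDir g)‖ :=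
          norm_add_le _ _
      _ = (1 - 4 * τ) + 4 * τ * ‖eoCenter g + ((eoRad g - eoKap g : ℝ) : ℂ) * eoDir g‖ := by
          rw [norm_mul, norm_mul, norm_branchPt, mul_one, Complex.norm_real, Complex.norm_real, Real.norm_eq_abs,
            Real.norm_eq_abs, abs_of_nonneg h14, abs_of_nonneg (by linarith [hτ.1])]
      _ ≤ (1 - 4 * τ) + 4 * τ * 1 := by nlinarith [mul_le_mul_of_nonneg_left (norm_Pin_le hg) (by linarith [hτ.1] : (0:ℝ) ≤ 4 * τ)]
      _ = 1 := by ring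
  · rw [eoPath_of_mem_rad ⟨h4.le, h⟩]
    have hρ := eoRho_mem hg ⟨h4.le, h⟩
    have h0 : 0 ≤ eoRho g τ := by have := eoRad_ge g; have := (eoKap_bounds hg).2; linarith [hρ.1]
    have := norm_ray_le hg h0 hρ.2
    have : 0 ≤ 1 - eoRho g τ / ‖branchPt g 4 - eoCenter g‖ := by
      rw [sub_nonneg, div_le_one (norm_four_sub_center_pos hg)]; exact hρ.2
    nlinarith

/-! ## §3 The sheet loop, its shadow, and its reverse -/

/-- `‖(1 : ℂ)‖ ≤ 1`. [folklore] -/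
theorem norm_one_le_one'' : ‖(1 : ℂ)‖ ≤ 1 := by simp

/-- **Sub-goal `helper_eOne_sheetLoop`** (H5-4 of the `e_1`-curve (R-E1CURVE) for node N3a of NF4):
the sheet loop of `page g 1` over the closed path `eoPath g` (`ζ_3 →` straight `→ P_in →` radially
`→ ζ_4` and back; upper sheet out, lower sheet back) exists as a continuous circle map of the page
and has homology shadow `chainVec g 3` (`g ≥ 2`). [cite: Milnor1968, Thm. 9.1] -/
theorem helper_eOne_sheetLoop : ∀ (g : ℕ) (_hg : 2 ≤ g), ∃ (L : Metric.sphere (0 : EuclideanSpace ℝ (Fin 2)) 1 → Literature.Topology.FourManifolds.LefschetzBase.Base g) (hL : Continuous L), (∀ θ, L θ ∈ Literature.Topology.FourManifolds.LefschetzBase.page g 1) ∧ (∀ τ ∈ Set.Icc (0 : ℝ) 1, (L (Literature.Topology.FourManifolds.circlePt τ)).1 = Summit.SmoothPoincare4.SmoothPoincare4.Theorems.AcyclicBisectionExists.ModpBraidOrbits.sheetAmb g 1 τ (Summit.SmoothPoincare4.SmoothPoincare4.Theorems.AcyclicBisectionExists.ModpBraidOrbits.eoPath g τ)) ∧ Literature.Topology.FourManifolds.LefschetzBase.shadow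 g L hL = Literature.Topology.FourManifolds.LefschetzBase.chainVec g 3 := by
  intro g hg
  obtain ⟨h0, h1, hh⟩ := eoPath_ends hg
  have hb3 : branchPt g 3 ^ (2 * g + 1) + 1 = 0 := by rw [branchPt_pow]; ring
  have hb4 : branchPt g 4 ^ (2 * g + 1) + 1 = 0 := by rw [branchPt_pow]; ring
  obtain ⟨L, hL, hLτ, hLp⟩ := exists_sheetCircle (g := g) norm_one_le_one'' (eoPath g) (continuous_eoPath g).continuousOn
    (fun τ hτ => norm_eoPath_le hg hτ) (h0.trans h1.symm) (by rw [h0]; exact hb3) (by rw [hh]; exact hb4)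
  refine ⟨L, hL, hLp, hLτ, ?_⟩
  -- the chain loop over `[ζ_3, ζ_4]` and the straight-line family of sheet loops
  obtain ⟨K, hK, hKτ⟩ := exists_chainCircle g 3
  have hKsh := helper_shadow_sheetLoop_chain g 3 (by omega) K hK hKτ
  obtain ⟨c0, c1, ch⟩ := chordZig_ends g 3
  rw [← hKsh]
  symm
  refine shadow_eq_of_sheet_family (c := 1) norm_one_le_one'' (fun s => s) continuousOn_id
    (fun s hs => by rw [abs_of_nonneg hs.1]; exact hs.2)
    (fun s τ => (1 - s) * chordZig g 3 τ + s * eoPath g τ) ?_ ?_ ?_ ?_ ?_ hK hL ?_ ?_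
  · have hc : Continuous fun p : ℝ × ℝ => ((1 - p.1 : ℝ) : ℂ) * chordZig g 3 p.2 + (p.1 : ℂ) * eoPath g p.2 :=
      ((Complex.continuous_ofReal.comp (continuous_const.sub continuous_fst)).mul
        ((continuous_chordZig g 3).comp continuous_snd)).add
        ((Complex.continuous_ofReal.comp continuous_fst).mul ((continuous_eoPath g).comp continuous_snd))
    refine hc.continuousOn.congr fun p _ => ?_
    simp only [uncurry]; push_cast; ring
  · intro s hs τ hτ
    have e : (1 - (s : ℂ)) * chordZig g 3 τ + (s : ℂ) * eoPath g τ =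
        ((1 - s : ℝ) : ℂ) * chordZig g 3 τ + (s : ℂ) * eoPath g τ := by push_cast; ring
    show ‖(1 - (s : ℂ)) * chordZig g 3 τ + (s : ℂ) * eoPath g τ‖ ≤ 1
    rw [e]
    calc ‖((1 - s : ℝ) : ℂ) * chordZig g 3 τ + (s : ℂ) * eoPath g τ‖
        ≤ ‖((1 - s : ℝ) : ℂ) * chordZig g 3 τ‖ + ‖(s : ℂ) * eoPath g τ‖ := norm_add_le _ _
      _ ≤ (1 - s) * 1 + s * 1 := by
          rw [norm_mul, norm_mul, Complex.norm_real, Complex.norm_real, Real.norm_eq_abs, Real.norm_eq_abs,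
            abs_of_nonneg (sub_nonneg.2 hs.2), abs_of_nonneg hs.1]
          exact add_le_add (mul_le_mul_of_nonneg_left (norm_chordZig_le g 3 hτ) (sub_nonneg.2 hs.2))
            (mul_le_mul_of_nonneg_left (norm_eoPath_le hg hτ) hs.1)
      _ = 1 := by ring
  · intro s _; simp only [c0, c1, h0, h1]
  · intro s _; simp only [c0, h0]; rw [← hb3]; ring
  · intro s _; simp only [ch, hh]; rw [← hb4]; push_cast; ring
  · intro τ hτ; rw [hKτ τ hτ]; push_cast; simp
  · intro τ hτ; rw [hLτ τ hτ]; push_cast; simp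

/-- **The reversed loop traces the same path with the sheets exchanged**: for `L` as above,
`L ∘ reflS` is a page loop with `(L ∘ reflS) (e^{2πit}) = L (e^{−2πit})` and, on `[0, 1]`,
`(L ∘ reflS)(e^{2πiτ}) = pagePt g 1 (eoPath g τ, −halfSign τ · √(eoPath g τ ^ (2g+1) + 1))`. [folklore] -/
theorem reverse_sheetLoop (hg : 2 ≤ g) {L : sphere (0 : EuclideanSpace ℝ (Fin 2)) 1 → Base g}
    (hLτ : ∀ τ ∈ Icc (0 : ℝ) 1, (L (circlePt τ)).1 = sheetAmb g 1 τ (eoPath g τ)) :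
    (∀ t : ℝ, (L ∘ reflS) (circlePt t) = L (circlePt (-t))) ∧
    ∀ τ ∈ Icc (0 : ℝ) 1, ((L ∘ reflS) (circlePt τ)).1 =
      pagePt g 1 (eoPath g τ) (-halfSign τ * csqrt (eoPath g τ ^ (2 * g + 1) + 1)) := by
  have hRt : ∀ t : ℝ, (L ∘ reflS) (circlePt t) = L (circlePt (-t)) := fun t => by rw [comp_apply, reflS_circlePt]
  refine ⟨hRt, fun τ hτ => ?_⟩
  rw [hRt, show -τ = (1 - τ) + (-1 : ℤ) by push_cast; ring, circlePt_add_int,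
    hLτ (1 - τ) ⟨by linarith [hτ.2], by linarith [hτ.1]⟩, eoPath_one_sub, sheetAmb]
  by_cases h : τ = 1 / 2
  · subst h
    have hh := (eoPath_ends hg).2.2
    rw [hh]
    exact pagePt_sheet_branch (by rw [branchPt_pow]; ring) _ _
  · congr 1
    unfold halfSign
    by_cases h1 : τ ≤ 1 / 2
    · have : ¬ (1 - τ ≤ 1 / 2) := fun h2 => h (by linarith)
      rw [if_neg this, if_pos h1]
    · rw [if_pos (by linarith), if_neg h1, neg_neg]

end Summit.SmoothPoincare4.SmoothPoincare4.Theorems.AcyclicBisectionExists.ModpBraidOrbits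

end
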